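/-
Copyright (c) 2026 the pub-hodgecm-mathlib formalisation cell (harness21).  Prover seat hodgecm-mathlib-LH4-p11 (g8), Track A «(D-RAM) FOUR-FRAME» squad, helper lane on
h413 = stmt-HodgeConjecture-24833 (count-neutral).  Heir dealer∕pen LH4-plan (g13) WORD #70 (2) «(β-BAL) producer»; SPEC-B2 v1 3227ed60 brick (B2a-1).  2026-09-04.
-/
import Summits.HodgeConjecture.HodgeConjecture.Theorems.F0P3cDyRamDiagonalPairReindex   -- ★ (O2a) p855745 (LH4-p04): `image_mapGL_diagGLUnits_zpow_normalisedPairs_eq`, `injOn_mapGL_diagGLUnits_zpow`, `finite_normalisedPairs_of_finite_fixed_vertices`,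
                                                                                          -- `ncard_setOf_mem_and_mem_eq_finsum_mem`, `ncard_setOf_mem_eq_sum`; brings ★ DEFS `normalisedStableLattices`, ★ H `finite_setOf_isVertexLattice_mapGL_diagonal_eq`, ★ `finite_setOf_normalised_diagonal_fixed_latt`
import HarnessLib

/-!
# Crux `H413`, line LH4 «(D-RAM) FOUR-FRAME» — (B2a-1) «(O2a) WITH A LABEL ON THE PAIR»: the signed eight-class sum of label-cut fixed-vertex counts re-indexed over `𝓛₀(T)`,
# for ANY weight `χ : (Fin 3 → Bool) → ℤ` and ANY class-dependent label `P e M` read AT THE VERTEX (no torus-invariance asked)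

Cell `hodgecm-mathlib` (D-0151), FLOOR 0, crux item H413 = `stmt-HodgeConjecture-24833`, route `HCCMUnconditional`; squad F0∕P3c∕LH4.  THEOREMS ONLY (no `def`, no instance,
no notation, no `sorry`, default heartbeats); ★-only imports; lane `--supports stmt-HodgeConjecture-24833 --as helper` (count-neutral); pays NO row, states NO law.

WHY (SPEC-B2 v1 §1–§2).  The (β-BAL) producer target is the eightfold ODD-character vanishing of the class-`+` clean-shell counts (★ p860156).  Its label — the norm-form class
`{Σ_j d_{e,j} x_j N(y_j) | y ∈ M}~ = valueSetMod X₊` — depends on the sign class `e` AND is only torus-EQUIVARIANT on (lattice, form) pairs, so ★ LH4-p09's labelled Stage A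
(`…DiagonalOrbitCountLabelled` ∕ `…DiagonalKappaOrbitCountLabelled`, label `Q M` with `Q(diag(z)M) ↔ Q M`) does not carry it.  The FIRST step of Stage A, however — ★ (O2a)'s
re-indexing `(M₀, b) ↦ diag(ϖ^{b})·M₀` — needs no invariance at all if the label is simply READ AT THE VERTEX `diag(ϖ^{b})·M₀`: this file records that step for an arbitrary
family of labels `P : (Fin 3 → Bool) → (lattices → Prop)` and an arbitrary weight `χ : (Fin 3 → Bool) → ℤ` (the even table `χ⁰_i` of (KMS) and the odd table `(−1)^{e_i}` of (β-BAL)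
alike).  The per-orbit fibre identity with the equivariant label ((B2a-2), SPEC §2) and the engine step ((B2a-3)) are separate bricks.
* §1 (generic `N`, one form): `image_mapGL_diagGLUnits_zpow_normalisedPairs_sepAt_eq`, `ncard_fixed_vertices_sepAt_eq_ncard_normalised_pairs`, `finite_normalisedPairs_sepAt`.
* §2 (`N = 3`): HEAD `cast_sum_mul_ncard_fixed_vertices_sepAt_eq_finsum` —
  `↑(Σ_e χ(e)·#{M : type t for diag(d_e), T·M = M, P e M}) = Σᶠ_{M₀ ∈ 𝓛₀(T)} Σ_e χ(e)·#{b : diag(ϖ^{b})·M₀ type t for diag(d_e) ∧ P e (diag(ϖ^{b})·M₀)}` over `ℚ`.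
HONEST LABEL.  Count-neutral bookkeeping; proves no census; (β-BAL), (A″), (β), T₊ OPEN; `HC_CM` is proved only modulo the 7 printed citations (2 remaining named inputs: hLiu418 =
`stmt-HodgeConjecture-24832`, h413 = `stmt-HodgeConjecture-24833`) until rung 0 closes.

## References
* [Kottwitz1986BaseChangeUnits] R. E. Kottwitz, *Base change for unit elements of Hecke algebras*, Compositio Math. 60 (1986), §1 pp. 240–241 (lattice counts regrouped modulo the
  diagonal torus).
* [Serre1980Trees] J.-P. Serre, *Trees*, Springer (1980), Ch. II §1.1 (lattices, diagonal translates, normal forms).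
* [BruhatTits1972] F. Bruhat, J. Tits, *Groupes réductifs sur un corps local I*, Publ. Math. IHÉS 41 (1972), §10.
* [LanglandsShelstad1987] R. P. Langlands, D. Shelstad, *On the definition of transfer factors*, Math. Ann. 278 (1987), §3 (the sign characters of `(ℤ∕2)³`).
-/

set_option autoImplicit false

noncomputable section

namespace Summit.HodgeConjecture.HodgeConjecture.Cruxes.H413.F0P3cDyRamDiagonalOrbitReindexPairLabel

open Literature.NumberTheory.Automorphic Literature.NumberTheory.Automorphic.HermitianLattice
open Literature.NumberTheory.Automorphic.UnitaryLatticeTree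
open Summit.HodgeConjecture.HodgeConjecture.Cruxes.H413.F0P3cDyRamDiagonalTorusDefs
open Summit.HodgeConjecture.HodgeConjecture.Cruxes.H413.F0P3cDyRamDiagonalPairReindex
open Summit.HodgeConjecture.HodgeConjecture.Cruxes.H413.F0P3cDyRamDiagonalFixedFinite
open Summit.HodgeConjecture.HodgeConjecture.Cruxes.H413.F0P3cDyRamDiagonalStableLatticesFinite
open scoped Valued WithZero Matrix MatrixGroups

/-! ## §1  The re-indexing with a label read at the vertex (generic `N`, one form, any type) -/

section Reindex

variable {K : Type*} [Field K] [Valued K ℤᵐ⁰] {N : ℕ}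

/-- **THE IMAGE of `(M₀, b) ↦ diag(ϖ^{b})·M₀` on the pairs `{(M₀, b) : M₀ ∈ 𝓛₀(T), diag(ϖ^{b})·M₀ a type-t vertex of diag(D), P(diag(ϖ^{b})·M₀)}` IS the label-cut fixed-vertex
set `{M : type-t vertex of diag(D), T·M = M, P M}`** — for ANY predicate `P` (read at the image vertex; ★ `image_mapGL_diagGLUnits_zpow_normalisedPairs_eq` cut by `P`).
[cite: Kottwitz1986BaseChangeUnits, §1 pp. 240–241] [cite: Serre1980Trees, II §1.1] -/
theorem image_mapGL_diagGLUnits_zpow_normalisedPairs_sepAt_eq (σ : K →+* K) {ϖ : K} (hϖ : Valued.v ϖ = WithZero.exp (-1 : ℤ)) (ϖu : Kˣ) (hϖu : (ϖu : K) = ϖ)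
    (D : Fin N → K) (t : ℕ) {s : Fin N → K} (T : GL (Fin N) K) (hT : (T : Matrix (Fin N) (Fin N) K) = Matrix.diagonal s)
    (P : Submodule 𝒪[K] (Fin N → K) → Prop) :
    (fun p : Submodule 𝒪[K] (Fin N → K) × (Fin N → ℤ) => mapGL (diagGLUnits fun i => ϖu ^ p.2 i) p.1) ''
        {p | p.1 ∈ normalisedStableLattices T ∧ IsVertexLattice σ ϖ (Matrix.diagonal D) t (mapGL (diagGLUnits fun i => ϖu ^ p.2 i) p.1) ∧
          P (mapGL (diagGLUnits fun i => ϖu ^ p.2 i) p.1)} =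
      {M : Submodule 𝒪[K] (Fin N → K) | IsVertexLattice σ ϖ (Matrix.diagonal D) t M ∧ mapGL T M = M ∧ P M} := by
  have himg := image_mapGL_diagGLUnits_zpow_normalisedPairs_eq σ hϖ ϖu hϖu D t T hT
  ext M
  constructor
  · rintro ⟨p, ⟨hp1, hV, hP⟩, rfl⟩
    have hmem : mapGL (diagGLUnits fun i => ϖu ^ p.2 i) p.1 ∈
        (fun p : Submodule 𝒪[K] (Fin N → K) × (Fin N → ℤ) => mapGL (diagGLUnits fun i => ϖu ^ p.2 i) p.1) ''
          {p | p.1 ∈ normalisedStableLattices T ∧ IsVertexLattice σ ϖ (Matrix.diagonal D) t (mapGL (diagGLUnits fun i => ϖu ^ p.2 i) p.1)} :=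
      ⟨p, ⟨hp1, hV⟩, rfl⟩
    rw [himg] at hmem
    exact ⟨hmem.1, hmem.2, hP⟩
  · rintro ⟨hV, hTM, hPM⟩
    have hmem : M ∈ (fun p : Submodule 𝒪[K] (Fin N → K) × (Fin N → ℤ) => mapGL (diagGLUnits fun i => ϖu ^ p.2 i) p.1) ''
        {p | p.1 ∈ normalisedStableLattices T ∧ IsVertexLattice σ ϖ (Matrix.diagonal D) t (mapGL (diagGLUnits fun i => ϖu ^ p.2 i) p.1)} := by
      rw [himg]
      exact ⟨hV, hTM⟩
    obtain ⟨p, ⟨hp1, hVp⟩, hp⟩ := hmem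
    have hp' : mapGL (diagGLUnits fun i => ϖu ^ p.2 i) p.1 = M := hp
    exact ⟨p, ⟨hp1, hVp, by rw [hp']; exact hPM⟩, hp⟩

/-- **«PAIRS RE-INDEXED BY NORMALISATION» WITH A LABEL READ AT THE VERTEX, ONE FORM**:
`#{M : type t for diag(D), T·M = M, P M} = #{(M₀, b) : M₀ ∈ 𝓛₀(T), diag(ϖ^{b})·M₀ type t for diag(D), P(diag(ϖ^{b})·M₀)}` (★ `injOn_mapGL_diagGLUnits_zpow` + §1 image;
`Set.ncard`, both `0` if infinite). [cite: Kottwitz1986BaseChangeUnits, §1 pp. 240–241] [cite: Serre1980Trees, II §1.1] [cite: BruhatTits1972, §10] -/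
theorem ncard_fixed_vertices_sepAt_eq_ncard_normalised_pairs (σ : K →+* K) {ϖ : K} (hϖ : Valued.v ϖ = WithZero.exp (-1 : ℤ)) (ϖu : Kˣ) (hϖu : (ϖu : K) = ϖ)
    (D : Fin N → K) (t : ℕ) {s : Fin N → K} (T : GL (Fin N) K) (hT : (T : Matrix (Fin N) (Fin N) K) = Matrix.diagonal s)
    (P : Submodule 𝒪[K] (Fin N → K) → Prop) :
    {M : Submodule 𝒪[K] (Fin N → K) | IsVertexLattice σ ϖ (Matrix.diagonal D) t M ∧ mapGL T M = M ∧ P M}.ncard =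
      {p : Submodule 𝒪[K] (Fin N → K) × (Fin N → ℤ) | p.1 ∈ normalisedStableLattices T ∧
        IsVertexLattice σ ϖ (Matrix.diagonal D) t (mapGL (diagGLUnits fun i => ϖu ^ p.2 i) p.1) ∧ P (mapGL (diagGLUnits fun i => ϖu ^ p.2 i) p.1)}.ncard := by
  rw [← image_mapGL_diagGLUnits_zpow_normalisedPairs_sepAt_eq σ hϖ ϖu hϖu D t T hT P]
  refine Set.InjOn.ncard_image ((injOn_mapGL_diagGLUnits_zpow hϖ ϖu hϖu).mono fun p hp => ?_)
  obtain ⟨⟨hl, -, hn⟩, -⟩ := hp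
  exact ⟨hl, hn⟩

/-- The label-cut pair set is finite as soon as the `T`-fixed vertex set of `diag(D)` is (a subset of ★ `finite_normalisedPairs_of_finite_fixed_vertices`).
[cite: Kottwitz1986BaseChangeUnits, §1 pp. 240–241] [cite: Serre1980Trees, II §1.1] -/
theorem finite_normalisedPairs_sepAt (σ : K →+* K) {ϖ : K} (hϖ : Valued.v ϖ = WithZero.exp (-1 : ℤ)) (ϖu : Kˣ) (hϖu : (ϖu : K) = ϖ)
    (D : Fin N → K) (t : ℕ) {s : Fin N → K} (T : GL (Fin N) K) (hT : (T : Matrix (Fin N) (Fin N) K) = Matrix.diagonal s)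
    (P : Submodule 𝒪[K] (Fin N → K) → Prop)
    (hfin : {M : Submodule 𝒪[K] (Fin N → K) | IsVertexLattice σ ϖ (Matrix.diagonal D) t M ∧ mapGL T M = M}.Finite) :
    {p : Submodule 𝒪[K] (Fin N → K) × (Fin N → ℤ) | p.1 ∈ normalisedStableLattices T ∧
        IsVertexLattice σ ϖ (Matrix.diagonal D) t (mapGL (diagGLUnits fun i => ϖu ^ p.2 i) p.1) ∧ P (mapGL (diagGLUnits fun i => ϖu ^ p.2 i) p.1)}.Finite :=
  (finite_normalisedPairs_of_finite_fixed_vertices σ hϖ ϖu hϖu D t T hT hfin).subset fun _ hp => ⟨hp.1, hp.2.1⟩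

end Reindex

/-! ## §2  HEAD: the signed eight-class sum with class-dependent labels, re-indexed over `𝓛₀(T)` (`N = 3`) -/

section Signed

variable {K : Type*} [Field K] [Valued K ℤᵐ⁰]

/-- **(O2a) WITH A WEIGHT AND A CLASS-DEPENDENT LABEL READ AT THE VERTEX.**  Finite residue field, valuation-preserving `σ`, uniformiser `ϖ = ↑ϖu`, a unit `c`, a regular unit
diagonal `T = diag(s)`, a type `t`, ANY weight `χ : (Fin 3 → Bool) → ℤ` and ANY family of labels `P e` (one per sign class, no invariance asked):
`↑(Σ_e χ(e) · #{M : type t for diag(d_e), T·M = M, P e M}) = Σᶠ_{M₀ ∈ 𝓛₀(T)} Σ_e χ(e) · #{b : diag(ϖ^{b})·M₀ type t for diag(d_e) ∧ P e (diag(ϖ^{b})·M₀)}` over `ℚ`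
(`d_e j = c` if `e j` else `1`) — class by class §1, every fibre finite (★ H through ★ (O2a)), then `Finset.sum_comm`.  With `χ = χ⁰_i` and `P ≡ True` this is ★ (Oκ2a); with
`χ(e) = (−1)^{e_i}` and `P e M` = «level tokens ∧ {Σ d_{e,j}x_jN(y_j)}~ = valueSetMod X₊» it is the first step of the labelled-odd Stage A of (β-BAL) (SPEC-B2 (B2a-1)).
[cite: Kottwitz1986BaseChangeUnits, §1 pp. 240–241] [cite: Serre1980Trees, II §1.1] [cite: LanglandsShelstad1987, §3] -/
theorem cast_sum_mul_ncard_fixed_vertices_sepAt_eq_finsum [Finite 𝓀[K]] {σ : K →+* K}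
    (hvσ : ∀ a, Valued.v (σ a) = Valued.v a) {ϖ : K} (hϖ : Valued.v ϖ = WithZero.exp (-1 : ℤ)) (ϖu : Kˣ) (hϖu : (ϖu : K) = ϖ)
    {c : K} (hcv : Valued.v c = 1) {s : Fin 3 → K} (hs : ∀ i, Valued.v (s i) = 1) (hreg : ∀ i j, i ≠ j → s i ≠ s j)
    (T : GL (Fin 3) K) (hT : (T : Matrix (Fin 3) (Fin 3) K) = Matrix.diagonal s) (t : ℕ)
    (χ : (Fin 3 → Bool) → ℤ) (P : (Fin 3 → Bool) → Submodule 𝒪[K] (Fin 3 → K) → Prop) :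
    (((∑ e : Fin 3 → Bool, χ e *
        ({M : Submodule 𝒪[K] (Fin 3 → K) |
          IsVertexLattice σ ϖ (Matrix.diagonal fun j => if e j then c else (1 : K)) t M ∧ mapGL T M = M ∧ P e M}.ncard : ℤ) : ℤ) : ℚ)) =
      ∑ᶠ M₀ ∈ normalisedStableLattices T, ∑ e : Fin 3 → Bool, (χ e : ℚ) *
        ((({b : Fin 3 → ℤ | IsVertexLattice σ ϖ (Matrix.diagonal fun j => if e j then c else (1 : K)) t (mapGL (diagGLUnits fun j => ϖu ^ b j) M₀) ∧
            P e (mapGL (diagGLUnits fun j => ϖu ^ b j) M₀)} : Set _).ncard : ℕ) : ℚ) := by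
  classical
  have hd : ∀ (e : Fin 3 → Bool) (j : Fin 3), Valued.v (if e j then c else (1 : K)) = 1 := by
    intro e j; split_ifs
    · exact hcv
    · exact map_one _
  have hs' : ∀ j, Valued.v (s j) ≤ 1 := fun j => (hs j).le
  have hinj : Function.Injective s := fun j j' hjj => by
    by_contra h; exact hreg j j' h hjj
  have h𝓛 : (normalisedStableLattices T).Finite := finite_setOf_normalised_diagonal_fixed_latt hϖ s hs hreg T hT
  -- every labelled pair set is finite, class by class, hence so is every fibre
  have hSR : ∀ e : Fin 3 → Bool, {p : Submodule 𝒪[K] (Fin 3 → K) × (Fin 3 → ℤ) | p.1 ∈ normalisedStableLattices T ∧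
      IsVertexLattice σ ϖ (Matrix.diagonal fun j => if e j then c else (1 : K)) t (mapGL (diagGLUnits fun j => ϖu ^ p.2 j) p.1) ∧
        P e (mapGL (diagGLUnits fun j => ϖu ^ p.2 j) p.1)}.Finite := fun e =>
    finite_normalisedPairs_sepAt σ hϖ ϖu hϖu _ t T hT (P e) (finite_setOf_isVertexLattice_mapGL_diagonal_eq hvσ hϖ (hd e) s hs' hinj T hT t)
  have hA : ∀ (e : Fin 3 → Bool), ∀ M₀ ∈ normalisedStableLattices T, ({b : Fin 3 → ℤ |
      IsVertexLattice σ ϖ (Matrix.diagonal fun j => if e j then c else (1 : K)) t (mapGL (diagGLUnits fun j => ϖu ^ b j) M₀) ∧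
        P e (mapGL (diagGLUnits fun j => ϖu ^ b j) M₀)} : Set _).Finite :=
    fun e M₀ hM₀ => ((hSR e).preimage (Prod.mk_right_injective M₀).injOn).subset fun b hb => ⟨hM₀, hb⟩
  -- class by class: §1 bijection, then fibrewise count over `𝓛₀(T)`
  have h1 : ∀ e : Fin 3 → Bool, ({M : Submodule 𝒪[K] (Fin 3 → K) |
        IsVertexLattice σ ϖ (Matrix.diagonal fun j => if e j then c else (1 : K)) t M ∧ mapGL T M = M ∧ P e M}.ncard : ℕ) =
      ∑ M₀ ∈ h𝓛.toFinset, ({b : Fin 3 → ℤ |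
        IsVertexLattice σ ϖ (Matrix.diagonal fun j => if e j then c else (1 : K)) t (mapGL (diagGLUnits fun j => ϖu ^ b j) M₀) ∧
          P e (mapGL (diagGLUnits fun j => ϖu ^ b j) M₀)} : Set _).ncard := fun e => by
    rw [ncard_fixed_vertices_sepAt_eq_ncard_normalised_pairs σ hϖ ϖu hϖu _ t T hT (P e), ← finsum_mem_eq_finite_toFinset_sum _ h𝓛]
    exact ncard_setOf_mem_and_mem_eq_finsum_mem h𝓛 (fun M₀ => ({b : Fin 3 → ℤ |
      IsVertexLattice σ ϖ (Matrix.diagonal fun j => if e j then c else (1 : K)) t (mapGL (diagGLUnits fun j => ϖu ^ b j) M₀) ∧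
        P e (mapGL (diagGLUnits fun j => ϖu ^ b j) M₀)} : Set _)) (hA e)
  rw [finsum_mem_eq_finite_toFinset_sum _ h𝓛, Finset.sum_comm]
  push_cast
  refine Finset.sum_congr rfl fun e _ => ?_
  rw [h1 e, Nat.cast_sum, Finset.mul_sum]

end Signed

end Summit.HodgeConjecture.HodgeConjecture.Cruxes.H413.F0P3cDyRamDiagonalOrbitReindexPairLabel

end
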